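import Summits.AtomisticToContinuum.Crystallization.Theorems.FreeSplittingCertificatesStrictSplittingRuleTorusModel442A
import Summits.AtomisticToContinuum.Crystallization.Theorems.FreeSplittingCertificatesStrictSplittingRuleTorusModel442B
import Summits.AtomisticToContinuum.Crystallization.Theorems.FreeSplittingCertificatesStrictSplittingRuleTorusQFormReal

/-!
# The joint (r6) sitewise LMI on the hcp torus 4×4×2 for REAL displacement fields (finite model of H12⋆)

Route `FreeSplittingCertificates`, crux `StrictSplittingRule` (stmt-AtomisticToContinuum-12560); unit b2b-freesplit-B (block 2b,
PART B, gen 1).  **VALUE = theorems about a FINITE model — NOT summit progress**; `stub_coreJointCoercive` is not proved.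

`…TorusModel442A/B.lean` state the torus LMI for rational fields `u : Fin 192 → ℚ`.  The displacement fields of
`CoreJointSiteIneq` are real; here the SAME model (same term lists of `…TorusModel442Defs.lean`, evaluated by `evalQR` of
`…TorusQFormReal.lean` with the rational coefficients cast) is stated over any linearly ordered field `R` — in particular
`R = ℝ` — and the SAME rational certificates `certA_valid`, `certB_valid` (already kernel-accepted, computational lane) give

* `jointLMI442A_real : ∀ u : Fin 192 → R, demandR siteA u + margin442 · normSqGR u ≤ supplyR siteA u + transferR siteA u + meanProjR u`,
* `jointLMI442A_real_zeroMean` (without `meanProjR` when `Σ_q u_(q,c) = 0`), and the same for the B site.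

No new computation: pure bookkeeping over the landed certificates. [folklore]
-/

namespace Summit.AtomisticToContinuum.Crystallization.Theorems.StrictSplittingRuleTorusLMI

open Literature.Computation.Certificates

variable {R : Type*} [Field R] [LinearOrder R] [IsStrictOrderedRing R]

/-- SUPPLY `S_p(u)` at an `R`-valued field. [folklore] -/
def supplyR (p : Site) (u : Fin 192 → R) : R := evalQR (supplyTerms p (thetaList p)) u
/-- TRANSFERS `T_p(u)` at an `R`-valued field. [folklore] -/
def transferR (p : Site) (u : Fin 192 → R) : R := evalQR (transferTerms p tableClasses) u
/-- DEMAND `D_p(u)` (κ-terms + readout form) at an `R`-valued field. [folklore] -/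
def demandR (p : Site) (u : Fin 192 → R) : R :=
  evalQR (kappaTerms p (thetaList p)) u + evalQR (readoutTerms p (thetaList p) betaTable) u
/-- `‖u‖²_G` at an `R`-valued field. [folklore] -/
def normSqGR (u : Fin 192 → R) : R := evalQR normTerms u
/-- `meanProj u = Σ_c (g_c/64)(Σ_q u_(q,c))²` at an `R`-valued field. [folklore] -/
def meanProjR (u : Fin 192 → R) : R := evalQR projTerms u

omit [LinearOrder R] [IsStrictOrderedRing R] in
/-- `evalQR (negTerms ts) = −evalQR ts`. [folklore] -/
theorem evalQR_negTerms [CharZero R] (ts : List (Term 192)) (u : Fin 192 → R) :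
    evalQR (negTerms ts) u = -evalQR ts u := by
  induction ts with
  | nil => simp [negTerms]
  | cons t ts ih =>
    simp only [negTerms, List.map_cons, evalQR_cons] at ih ⊢
    rw [ih]; push_cast; ring

omit [LinearOrder R] [IsStrictOrderedRing R] in
/-- `evalQR (scaleTerms a ts) = a · evalQR ts`. [folklore] -/
theorem evalQR_scaleTerms [CharZero R] (a : ℚ) (ts : List (Term 192)) (u : Fin 192 → R) :
    evalQR (scaleTerms a ts) u = (a : R) * evalQR ts u := by
  induction ts with
  | nil => simp [scaleTerms]
  | cons t ts ih =>
    simp only [scaleTerms, List.map_cons, evalQR_cons] at ih ⊢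
    rw [ih]; push_cast; ring

/-- The certificate's form over `R`: `S + T − D − m‖u‖² + meanProj`. [folklore] -/
theorem evalQR_certTerms (p : Site) (m : ℚ) (u : Fin 192 → R) :
    evalQR (certTerms p m) u = supplyR p u + transferR p u - demandR p u - (m : R) * normSqGR u + meanProjR u := by
  simp only [certTerms, evalQR_append, evalQR_negTerms, evalQR_scaleTerms, supplyR, transferR, demandR, normSqGR,
    meanProjR]
  push_cast
  ring

/-- `meanProjR` vanishes on zero-mean fields. [folklore] -/
theorem meanProjR_eq_zero {u : Fin 192 → R} (h0 : ∀ c : Fin 3, (sumF c).evalR u = 0) : meanProjR u = 0 := by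
  simp [meanProjR, projTerms, sq, evalQR_cons, h0]

/-- **The joint (r6) sitewise LMI at the A site of the 4×4×2 torus for `R`-valued (e.g. REAL) displacement fields**,
margin `m = 39101/2²⁰`: `D_p(u) + m‖u‖²_G ≤ S_p(u) + T_p(u) + meanProj(u)`.  Finite model of H12⋆, not the stub. -/
theorem jointLMI442A_real (u : Fin 192 → R) :
    demandR siteA u + (margin442 : R) * normSqGR u ≤ supplyR siteA u + transferR siteA u + meanProjR u := by
  have h := evalQR_nonneg_of_certDD (ts := certTerms siteA margin442) rfl certA_valid u
  rw [evalQR_certTerms] at h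
  linarith

/-- **The same at the B site.** -/
theorem jointLMI442B_real (u : Fin 192 → R) :
    demandR siteB u + (margin442 : R) * normSqGR u ≤ supplyR siteB u + transferR siteB u + meanProjR u := by
  have h := evalQR_nonneg_of_certDD (ts := certTerms siteB margin442) rfl certB_valid u
  rw [evalQR_certTerms] at h
  linarith

/-- **Zero-mean form, A site, `R`-valued fields**: `Σ_q u_(q,c) = 0` (`c = 0,1,2`) ⇒ `D_p(u) + m‖u‖²_G ≤ S_p(u) + T_p(u)`. -/
theorem jointLMI442A_real_zeroMean (u : Fin 192 → R) (h0 : ∀ c : Fin 3, (sumF c).evalR u = 0) :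
    demandR siteA u + (margin442 : R) * normSqGR u ≤ supplyR siteA u + transferR siteA u := by
  have h := jointLMI442A_real u
  rw [meanProjR_eq_zero h0, add_zero] at h
  exact h

/-- **Zero-mean form, B site, `R`-valued fields.** -/
theorem jointLMI442B_real_zeroMean (u : Fin 192 → R) (h0 : ∀ c : Fin 3, (sumF c).evalR u = 0) :
    demandR siteB u + (margin442 : R) * normSqGR u ≤ supplyR siteB u + transferR siteB u := by
  have h := jointLMI442B_real u
  rw [meanProjR_eq_zero h0, add_zero] at h
  exact h

end Summit.AtomisticToContinuum.Crystallization.Theorems.StrictSplittingRuleTorusLMI
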